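import Literature.NumberTheory.EllipticCurves.Kato2004.IwasawaCohomology
import Literature.NumberTheory.EllipticCurves.Kobayashi2003.SignedSelmer
import Literature.NumberTheory.EllipticCurves.CyclotomicZpExtensionLocalGeneratorProofs
import HarnessLib

/-!
# Route `ThetaPartnerAtTwo` (TP2), crux K3 `SignedKatoDivisibilityUpToAtTwo` (item stmt-BirchSwinnertonDyer-20308),
# line `colemanrat` v7 — (D-layer) brick: LOCALISATION COMMUTES WITH THE LAYER CORESTRICTIONS when the place does not
# split in the layer: `loc_{U} ∘ cor_{N → U} = cor_{N_E → U_E} ∘ loc_{N}` on `H¹` (the one-double-coset Mackey formula,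
# read along the local restriction `Γ_{K_v} → Γ_K`), and its instance for the cyclotomic `ℤ_p`-tower of `ℚ` at `v ∣ p`

Width seat `bsd-wall-tp2-p2x-w3` g4 (cell `bsd-wall`). HONEST FRAMING: THEOREMS ONLY — no definition, no named fact, no
instance, no `sorry`; route-independent; closes no item; BSD is NOT proved by any of this.

## Why this file

The research stub (R2c) `Cruxes.SignedKatoDivisibilityUpToAtTwo.ColemanRat.stub_layerSideTwoInv` asks for `ℤ₂`-linear LAYER
pairings `pair n : H¹(ℚ_n, T₂W) → Hom(E(ℚ_{2,n}·ℚ_v), ℤ₂)` with the projection formula (P1)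
`pair n (layerCores x) Q = pair (n + 1) x Q`. Whatever the model of `pair n`, its first argument enters through the
LOCALISATION `loc_n : H¹(Γ_n, T) → H¹(U_n, T)`, `U_n = Gal(K̄_v/K_{n,v}) = localSubgroupOfEmb (Γ_n) ι ≤ Γ_{K_v}` (pull
back along `resGalSubgroupOfEmb`), and the first step of (P1) is to move the GLOBAL trace map
`layerCores = cor_{Γ_{n+1} → Γ_n}` (Kato §12.2) through `loc`: when `v` does not split in `K_{n+1}/K_n` (one double
coset `U_n \ Γ_n / Γ_{n+1}`), `loc_n ∘ cor_{Γ_{n+1} → Γ_n} = cor_{U_{n+1} → U_n} ∘ loc_{n+1}` — the LOCAL trace map of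
the layer `K_{n+1,v}/K_{n,v}`. This is Neukirch–Schmidt–Wingberg (1.5.6)–(1.5.7) with a single term, the same
computation as the tree's `resSubgroup_cores_eq_cores_subgroupOf` (`ContinuousCorestrictionResMackey.lean`, where `D ≤ G`
is a subgroup) but along the continuous homomorphism `resGalOfEmb ι : Γ_{K_v} → Γ_K` (whose image is `D_v`) instead of
an inclusion, so that the result lives directly in the cohomology of the LOCAL groups `U_n ≤ Γ_{K_v}` where the tree's
local Kummer theory and invariant maps live (`LocalKummerMap`, `LocalInvariantMap`).

## What is proved

* §1 (any `K`-field `E`, any `ι : K̄ → K̄_E`, any topological coefficients `X : TopRep R Γ_K`, subgroups `N ≤ U ≤ Γ_K`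
  with `N` open of finite index in `U`, and the ONE-COSET hypothesis «every coset of `N` in `U` meets the image of
  `Γ_E`»): **`map_resGalSubgroupOfEmb_coresLe`** — `loc_U (cor_{N → U} c) = cor_{N_E → U_E} (loc_N c)` on `H¹`,
  where `loc` is Mathlib's `ContinuousCohomology.map` along `(resGalSubgroupOfEmb · ι, id)` and the corestrictions are
  the tree's relative `coresLe` (explicit transfer). Proof: representatives of `U ⧸ N` chosen as images of
  representatives of `U_E ⧸ N_E` along the induced bijection; then the two transfer sums agree term by term.
* §2 (a `ℤ_p`-extension `κ` of `K`): the one-coset hypothesis for the layers `Γ_{n+1} ≤ Γ_n` follows from the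
  surjectivity of `κ ∘ res : Γ_E → ℤ_p` onto `κ(Γ_K)`-values (`forall_exists_layer_of_surjective`), and
  **`map_resGalSubgroupOfEmb_layerCores`** — `loc_n (layerCores x) = cor_{U_{n+1} → U_n} (loc_{n+1} x)` for Kato's
  `layerCores` (`Kato2004/IwasawaCohomology.lean`), any `GaloisRep`.
* §3 (`K = ℚ`, `κ` cyclotomic, `v ∣ p`, `ι = closureEmb`): the hypothesis holds (`κ ∘ res` is ONTO,
  `ZpExtension.IsCyclotomic.exists_apply_resGalOfEmb_adicCompletion_eq`: `p` is totally ramified in `ℚ_∞`), whence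
  **`map_resGalSubgroupOfEmb_layerCores_cyclotomic`** — unconditional, every `n`, every `p`, every `GaloisRep` of `Γ_ℚ`.

References: [NeukirchSchmidtWingberg2008] I §5 Prop. (1.5.6)–(1.5.7) (double coset formula); [Brown1982] III (9.5)(b);
[Kato2004Asterisque] §12.2 (p. 220) (the trace maps); [Kobayashi2003] §2 p. 4 («the prime `p` is totally ramified in `K_n`»),
(8.23) (p. 18); [Washington1997] §13.1.
-/

set_option autoImplicit false
-- the Theorems namespace of this sub repeats the summit name by design (D-0017 nested layout)
set_option linter.dupNamespace false

noncomputable section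

open scoped Classical

namespace Summit.BirchSwinnertonDyer.BirchSwinnertonDyer.Theorems

namespace SignedKatoOffTwo.LocalCores

open CategoryTheory Field NumberField IsDedekindDomain
  Literature.NumberTheory.EllipticCurves Literature.NumberTheory.GaloisRepresentations ZpExtension
open Literature.NumberTheory.EllipticCurves (schreierElt schreierElt_mem schreierElt_coe subgroupInclusion
  subgroupInclusion_apply_coe)

universe u w

/-! ## §1 Localisation commutes with the relative corestriction (one coset) -/

section Generic

variable {R : Type w} [Ring R] [TopologicalSpace R]
variable {K : Type u} [Field K] {E : Type u} [Field E] [Algebra K E] (ι : AlgebraicClosure K →ₐ[K] AlgebraicClosure E)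
  (X : TopRep.{u} R (absoluteGaloisGroup K)) {N U : Subgroup (absoluteGaloisGroup K)}

omit [TopologicalSpace R] in
/-- `N ≤ U` gives `N_E ≤ U_E` for the local subgroups `(Γ_E → Γ_K)⁻¹(·)`. [cite: NeukirchSchmidtWingberg2008, I §5 (1.5.6)–(1.5.7)] -/
theorem localSubgroupOfEmb_mono (hNU : N ≤ U) : localSubgroupOfEmb N ι ≤ localSubgroupOfEmb U ι :=
  Subgroup.comap_mono hNU

omit [TopologicalSpace R] in
/-- The local subgroup of an open subgroup is open (continuity of `Γ_E → Γ_K`). [cite: NeukirchSchmidtWingberg2008, I §5 (1.5.6)–(1.5.7)] -/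
theorem isOpen_localSubgroupOfEmb (hN : IsOpen (N : Set (absoluteGaloisGroup K))) :
    IsOpen (localSubgroupOfEmb N ι : Set (absoluteGaloisGroup E)) :=
  hN.preimage (map_continuous (resGalOfEmb ι))

/-- **Localisation commutes with the relative corestriction (one double coset).** For subgroups `N ≤ U ≤ Γ_K` with `N`
open and of finite index in `U`, a `K`-embedding `ι : K̄ → K̄_E` with local subgroups `N_E ≤ U_E ≤ Γ_E`, and the
hypothesis that every coset of `N` in `U` meets the image of `Γ_E` (for `U = Gal(K̄/L)`, `N = Gal(K̄/L')`: the place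
of `L` under `ι` does not split in `L'`), the localisation `H¹(U, X) → H¹(U_E, X)` (pull-back along `U_E → U`) carries
the corestriction `cor_{N → U}` to the LOCAL corestriction `cor_{N_E → U_E}` of the localised class:
`loc_U (cor c) = cor (loc_N c)`. [cite: NeukirchSchmidtWingberg2008, I §5 Prop. (1.5.6)–(1.5.7)] [cite: Brown1982, III (9.5)(b)] -/
theorem map_resGalSubgroupOfEmb_coresLe (hNU : N ≤ U) (hN : IsOpen (N : Set (absoluteGaloisGroup K)))
    [Fintype (U ⧸ N.subgroupOf U)]
    [Fintype (localSubgroupOfEmb U ι ⧸ (localSubgroupOfEmb N ι).subgroupOf (localSubgroupOfEmb U ι))]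
    (hcov : ∀ u ∈ U, ∃ t ∈ localSubgroupOfEmb U ι, (resGalOfEmb ι t)⁻¹ * u ∈ N)
    (c : continuousCohomology 1 (subgroupRep X N)) :
    ContinuousCohomology.map (resGalSubgroupOfEmb U ι) (X := subgroupRep X U)
        (Y := subgroupRep (TopRep.res (resGalOfEmb ι : absoluteGaloisGroup E →* absoluteGaloisGroup K) X)
          (localSubgroupOfEmb U ι))
        (TopRep.ofHom ⟨ContinuousLinearMap.id R X, fun _ => rfl⟩) 1 (coresLe X hNU hN c) =
      coresLe (TopRep.res (resGalOfEmb ι : absoluteGaloisGroup E →* absoluteGaloisGroup K) X)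
        (localSubgroupOfEmb_mono ι hNU) (isOpen_localSubgroupOfEmb ι hN)
        (ContinuousCohomology.map (resGalSubgroupOfEmb N ι) (X := subgroupRep X N)
          (Y := subgroupRep (TopRep.res (resGalOfEmb ι : absoluteGaloisGroup E →* absoluteGaloisGroup K) X)
            (localSubgroupOfEmb N ι))
          (TopRep.ofHom ⟨ContinuousLinearMap.id R X, fun _ => rfl⟩) 1 c) := by
  classical
  -- membership dictionaries
  have hmemU : ∀ x : U, x ∈ N.subgroupOf U ↔ (x : absoluteGaloisGroup K) ∈ N := fun x => Subgroup.mem_subgroupOf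
  have hmemE : ∀ t : localSubgroupOfEmb U ι, t ∈ (localSubgroupOfEmb N ι).subgroupOf (localSubgroupOfEmb U ι) ↔ resGalOfEmb ι (t : absoluteGaloisGroup E) ∈ N := fun t => by
    rw [Subgroup.mem_subgroupOf]; exact mem_localSubgroupOfEmb_iff N ι _
  -- the induced map `j : U_E ⧸ N_E → U ⧸ N`, `[t] ↦ [θ t]`, a `U_E`-equivariant bijection
  let θU : localSubgroupOfEmb U ι → U := fun t => ⟨resGalOfEmb ι t, t.2⟩
  have hθU : ∀ t : localSubgroupOfEmb U ι, ((θU t : U) : absoluteGaloisGroup K) = resGalOfEmb ι t := fun t => rfl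
  let j : localSubgroupOfEmb U ι ⧸ (localSubgroupOfEmb N ι).subgroupOf (localSubgroupOfEmb U ι) → U ⧸ N.subgroupOf U :=
    Quotient.map' θU fun a b hab => by
      rw [QuotientGroup.leftRel_apply] at hab ⊢
      rw [hmemU]
      have h := (hmemE _).mp hab
      simpa [θU, map_mul, map_inv] using h
  have hj_mk : ∀ t : localSubgroupOfEmb U ι, j (QuotientGroup.mk t) = QuotientGroup.mk (θU t) := fun t => rfl
  have hj_smul : ∀ (t : localSubgroupOfEmb U ι) (y : localSubgroupOfEmb U ι ⧸ (localSubgroupOfEmb N ι).subgroupOf (localSubgroupOfEmb U ι)), j (t • y) = θU t • j y := by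
    intro t y
    induction y using QuotientGroup.induction_on with
    | H e =>
      rw [MulAction.Quotient.smul_mk, hj_mk, hj_mk, MulAction.Quotient.smul_mk]
      congr 1
      apply Subtype.ext
      simp [θU, map_mul]
  have hj_inj : Function.Injective j := by
    intro y₁ y₂ hy
    induction y₁ using QuotientGroup.induction_on with
    | H t₁ =>
      induction y₂ using QuotientGroup.induction_on with
      | H t₂ =>
        rw [hj_mk, hj_mk, QuotientGroup.eq, hmemU] at hy
        refine QuotientGroup.eq.mpr ((hmemE _).mpr ?_)
        simpa [θU, map_mul, map_inv] using hy
  have hj_surj : Function.Surjective j := fun x => by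
    induction x using QuotientGroup.induction_on with
    | H u =>
      obtain ⟨t, htU, ht⟩ := hcov u u.2
      refine ⟨QuotientGroup.mk ⟨t, htU⟩, ?_⟩
      rw [hj_mk, QuotientGroup.eq, hmemU]
      simpa [θU] using ht
  -- representatives: `s'` of `U_E ⧸ N_E` arbitrary, `s := θ ∘ s' ∘ j⁻¹` of `U ⧸ N`
  let s' : localSubgroupOfEmb U ι ⧸ (localSubgroupOfEmb N ι).subgroupOf (localSubgroupOfEmb U ι) → localSubgroupOfEmb U ι := Quotient.out
  have hs' : ∀ y, (s' y : localSubgroupOfEmb U ι ⧸ (localSubgroupOfEmb N ι).subgroupOf (localSubgroupOfEmb U ι)) = y := fun y => Quotient.out_eq y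
  let jinv := Function.surjInv hj_surj
  have hjinv : ∀ x, j (jinv x) = x := Function.surjInv_eq hj_surj
  have hjinv' : ∀ y, jinv (j y) = y := fun y => hj_inj (hjinv (j y))
  let s : U ⧸ N.subgroupOf U → U := fun x => θU (s' (jinv x))
  have hs : ∀ x, (s x : U ⧸ N.subgroupOf U) = x := fun x => by
    change QuotientGroup.mk (θU (s' (jinv x))) = x
    rw [← hj_mk, hs', hjinv]
  have hs_j : ∀ y, s (j y) = θU (s' y) := fun y => by
    change θU (s' (jinv (j y))) = _
    rw [hjinv']
  -- both sides on cocycles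
  obtain ⟨φ, rfl⟩ := oneCocycleClass_surjective _ c
  rw [coresLe_oneCocycleClass X hNU hN hs φ, map_oneCocycleClass, map_oneCocycleClass,
    coresLe_oneCocycleClass _ _ _ hs']
  congr 1
  apply Subtype.ext
  ext t
  rw [contOneCocycles.pullback_apply, TopRep.hom_ofHom, transferCocycle_apply, transferFun_apply,
    transferCocycle_apply, transferFun_apply]
  change (∑ x : U ⧸ N.subgroupOf U, (subgroupRep X U).ρ (s (θU t • x))
      ((contOneCocycles.pullback (subgroupOfHom hNU) (Y := subgroupRep (subgroupRep X U) (N.subgroupOf U))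
        (TopRep.ofHom ⟨ContinuousLinearMap.id R X, fun _ => rfl⟩) φ).1
        (schreierElt (N.subgroupOf U) hs (θU t) x))) = _
  symm
  refine Fintype.sum_bijective j ⟨hj_inj, hj_surj⟩ _ _ fun y => ?_
  rw [← hj_smul, hs_j]
  change X.ρ (resGalOfEmb ι ((s' (t • y) : localSubgroupOfEmb U ι) : absoluteGaloisGroup E)) _ =
    X.ρ (resGalOfEmb ι ((s' (t • y) : localSubgroupOfEmb U ι) : absoluteGaloisGroup E)) _
  congr 1
  change φ.1 _ = φ.1 _
  congr 1
  apply Subtype.ext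
  change resGalOfEmb ι ((schreierElt ((localSubgroupOfEmb N ι).subgroupOf (localSubgroupOfEmb U ι)) hs' t y :
      localSubgroupOfEmb U ι) : absoluteGaloisGroup E) =
    ((schreierElt (N.subgroupOf U) hs (θU t) (j y) : U) : absoluteGaloisGroup K)
  rw [schreierElt_coe, schreierElt_coe]
  push_cast
  rw [map_mul, map_mul, map_inv, ← hj_smul, hs_j, hs_j, hθU, hθU, hθU]

end Generic

/-! ## §2 The layers of a `ℤ_p`-extension -/

section Layers

variable {K : Type u} [Field K] {E : Type u} [Field E] [Algebra K E] (ι : AlgebraicClosure K →ₐ[K] AlgebraicClosure E)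
  {p : ℕ} [Fact p.Prime] (κ : ZpExtension K p)

/-- **One coset per layer from local surjectivity of `κ`.** If `κ ∘ res : Γ_E → ℤ_p` takes every value `κ(u)`,
`u ∈ Γ_n` (e.g. `κ ∘ res` onto: the place is totally ramified in `K_∞`), then every coset of `Γ_{n+1}` in `Γ_n`
meets the image of `Γ_E`: given `u ∈ Γ_n` pick `t` with `κ(res t) = κ(u)`; then `res t ∈ Γ_n` and
`(res t)⁻¹ u ∈ ker κ ≤ Γ_{n+1}`. [cite: Kobayashi2003, §2 (p. 4)] [cite: Washington1997, §13.1] -/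
theorem forall_exists_layer_of_surjective (n : ℕ)
    (hsurj : ∀ u ∈ κ.layerSubgroup n, ∃ t : absoluteGaloisGroup E, κ (resGalOfEmb ι t) = κ u) :
    ∀ u ∈ κ.layerSubgroup n, ∃ t ∈ localSubgroupOfEmb (κ.layerSubgroup n) ι,
      (resGalOfEmb ι t)⁻¹ * u ∈ κ.layerSubgroup (n + 1) := by
  intro u hu
  obtain ⟨t, ht⟩ := hsurj u hu
  refine ⟨t, ?_, ?_⟩
  · rw [mem_localSubgroupOfEmb_iff, mem_layerSubgroup, ht]
    exact mem_layerSubgroup.mp hu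
  · apply κ.kerSubgroup_le_layerSubgroup (n + 1)
    rw [mem_kerSubgroup, map_mul, map_inv, ht, inv_mul_cancel]

/-- **Localisation commutes with Kato's layer trace maps** (`layerCores`, §12.2): for a `ℤ_p`-extension `κ` of `K`,
an embedding `ι : K̄ → K̄_E` such that every coset of `Γ_{n+1}` in `Γ_n` meets the image of `Γ_E` (the place under `ι`
does not split in `K_{n+1}/K_n`), and ANY `p`-adic (or topological) representation `T` of `Γ_K`:
`loc_n (layerCores x) = cor_{U_{n+1} → U_n} (loc_{n+1} x)` with `U_m = localSubgroupOfEmb (Γ_m) ι` the local layer groups.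
[cite: Kato2004Asterisque, §12.2 (p. 220)] [cite: NeukirchSchmidtWingberg2008, I §5 Prop. (1.5.6)–(1.5.7)] -/
theorem map_resGalSubgroupOfEmb_layerCores {A : Type} [CommRing A] [TopologicalSpace A] {M : Type}
    [AddCommGroup M] [Module A M] [TopologicalSpace M] [IsTopologicalAddGroup M] [ContinuousSMul A M]
    {E : Type} [Field E] [Algebra ℚ E] (ι : AlgebraicClosure ℚ →ₐ[ℚ] AlgebraicClosure E)
    (κ : ZpExtension ℚ p) (T : GaloisRep ℚ A M) (n : ℕ)
    [Fintype (localSubgroupOfEmb (κ.layerSubgroup n) ι ⧸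
      (localSubgroupOfEmb (κ.layerSubgroup (n + 1)) ι).subgroupOf (localSubgroupOfEmb (κ.layerSubgroup n) ι))]
    (hcov : ∀ u ∈ κ.layerSubgroup n, ∃ t ∈ localSubgroupOfEmb (κ.layerSubgroup n) ι,
      (resGalOfEmb ι t)⁻¹ * u ∈ κ.layerSubgroup (n + 1))
    (x : H1 T (κ.layerSubgroup (n + 1))) :
    ContinuousCohomology.map (resGalSubgroupOfEmb (κ.layerSubgroup n) ι) (X := subgroupRep T.toTopRep (κ.layerSubgroup n))
        (Y := subgroupRep (TopRep.res (resGalOfEmb ι : absoluteGaloisGroup E →* absoluteGaloisGroup ℚ) T.toTopRep)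
          (localSubgroupOfEmb (κ.layerSubgroup n) ι))
        (TopRep.ofHom ⟨ContinuousLinearMap.id A M, fun _ => rfl⟩) 1 (Kato2004.layerCores T κ n x) =
      coresLe (TopRep.res (resGalOfEmb ι : absoluteGaloisGroup E →* absoluteGaloisGroup ℚ) T.toTopRep)
        (localSubgroupOfEmb_mono ι (κ.layerSubgroup_antitone (Nat.le_succ n)))
        (isOpen_localSubgroupOfEmb ι (κ.isOpen_layerSubgroup (n + 1)))
        (ContinuousCohomology.map (resGalSubgroupOfEmb (κ.layerSubgroup (n + 1)) ι)
          (X := subgroupRep T.toTopRep (κ.layerSubgroup (n + 1)))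
          (Y := subgroupRep (TopRep.res (resGalOfEmb ι : absoluteGaloisGroup E →* absoluteGaloisGroup ℚ) T.toTopRep)
            (localSubgroupOfEmb (κ.layerSubgroup (n + 1)) ι))
          (TopRep.ofHom ⟨ContinuousLinearMap.id A M, fun _ => rfl⟩) 1 x) := by
  haveI : (κ.layerSubgroup (n + 1)).FiniteIndex :=
    finiteIndex_of_isOpen_of_compactSpace _ (κ.isOpen_layerSubgroup (n + 1))
  haveI : Fintype (κ.layerSubgroup n ⧸ (κ.layerSubgroup (n + 1)).subgroupOf (κ.layerSubgroup n)) := Fintype.ofFinite _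
  have h := map_resGalSubgroupOfEmb_coresLe ι T.toTopRep (κ.layerSubgroup_antitone (Nat.le_succ n))
    (κ.isOpen_layerSubgroup (n + 1)) hcov x
  unfold Kato2004.layerCores
  convert h using 5

end Layers

/-! ## §3 The cyclotomic `ℤ_p`-tower of `ℚ` at `v ∣ p` -/

section Cyclotomic

open scoped NumberField

variable {p : ℕ} [Fact p.Prime] (κ : ZpExtension ℚ p)

/-- **At `v ∣ p` every coset of `Γ_{n+1}` in `Γ_n` meets `Γ_{ℚ_v}`** for the cyclotomic `ℤ_p`-extension of `ℚ`
(`κ ∘ res : Γ_{ℚ_v} → ℤ_p` is onto: `p` is totally ramified in `ℚ_∞`). [cite: Washington1997, §13.1]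
[cite: Kobayashi2003, §2 (p. 4)] -/
theorem forall_exists_layer_cyclotomic (hκ : κ.IsCyclotomic) (v : HeightOneSpectrum (𝓞 ℚ))
    (hv : (p : 𝓞 ℚ) ∈ v.asIdeal) (n : ℕ) :
    ∀ u ∈ κ.layerSubgroup n, ∃ t ∈ localSubgroupOfEmb (κ.layerSubgroup n) (closureEmb (K := ℚ) (v.adicCompletion ℚ)),
      (resGalOfEmb (closureEmb (K := ℚ) (v.adicCompletion ℚ)) t)⁻¹ * u ∈ κ.layerSubgroup (n + 1) :=
  forall_exists_layer_of_surjective (closureEmb (K := ℚ) (v.adicCompletion ℚ)) κ n fun u _ =>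
    hκ.exists_apply_resGalOfEmb_adicCompletion_eq v hv (κ u)

/-- **Localisation at `v ∣ p` commutes with Kato's layer trace maps, unconditionally**, for the cyclotomic
`ℤ_p`-extension of `ℚ`, every layer `n` and every representation `T` of `Γ_ℚ`:
`loc_n (layerCores x) = cor_{U_{n+1} → U_n} (loc_{n+1} x)`, `U_m = Gal(ℚ̄_v/ℚ_{m,v})`. This is the first half of the
projection formula (P1) of the layer pairings of K3's (D-layer): the global trace becomes the LOCAL trace of
`ℚ_{n+1,v}/ℚ_{n,v}`. [cite: Kato2004Asterisque, §12.2 (p. 220)] [cite: Kobayashi2003, (8.23) (p. 18)]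
[cite: NeukirchSchmidtWingberg2008, I §5 Prop. (1.5.6)–(1.5.7)] -/
theorem map_resGalSubgroupOfEmb_layerCores_cyclotomic {A : Type} [CommRing A] [TopologicalSpace A] {M : Type}
    [AddCommGroup M] [Module A M] [TopologicalSpace M] [IsTopologicalAddGroup M] [ContinuousSMul A M]
    (hκ : κ.IsCyclotomic) (v : HeightOneSpectrum (𝓞 ℚ)) (hv : (p : 𝓞 ℚ) ∈ v.asIdeal) (T : GaloisRep ℚ A M) (n : ℕ)
    [Fintype (localSubgroupOfEmb (κ.layerSubgroup n) (closureEmb (K := ℚ) (v.adicCompletion ℚ)) ⧸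
      (localSubgroupOfEmb (κ.layerSubgroup (n + 1)) (closureEmb (K := ℚ) (v.adicCompletion ℚ))).subgroupOf
        (localSubgroupOfEmb (κ.layerSubgroup n) (closureEmb (K := ℚ) (v.adicCompletion ℚ))))]
    (x : H1 T (κ.layerSubgroup (n + 1))) :
    ContinuousCohomology.map (resGalSubgroupOfEmb (κ.layerSubgroup n) (closureEmb (K := ℚ) (v.adicCompletion ℚ)))
        (X := subgroupRep T.toTopRep (κ.layerSubgroup n))
        (Y := subgroupRep (TopRep.res (resGalOfEmb (closureEmb (K := ℚ) (v.adicCompletion ℚ)) :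
            absoluteGaloisGroup (v.adicCompletion ℚ) →* absoluteGaloisGroup ℚ) T.toTopRep)
          (localSubgroupOfEmb (κ.layerSubgroup n) (closureEmb (K := ℚ) (v.adicCompletion ℚ))))
        (TopRep.ofHom ⟨ContinuousLinearMap.id A M, fun _ => rfl⟩) 1 (Kato2004.layerCores T κ n x) =
      coresLe (TopRep.res (resGalOfEmb (closureEmb (K := ℚ) (v.adicCompletion ℚ)) :
            absoluteGaloisGroup (v.adicCompletion ℚ) →* absoluteGaloisGroup ℚ) T.toTopRep)
        (localSubgroupOfEmb_mono (closureEmb (K := ℚ) (v.adicCompletion ℚ)) (κ.layerSubgroup_antitone (Nat.le_succ n)))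
        (isOpen_localSubgroupOfEmb (closureEmb (K := ℚ) (v.adicCompletion ℚ)) (κ.isOpen_layerSubgroup (n + 1)))
        (ContinuousCohomology.map (resGalSubgroupOfEmb (κ.layerSubgroup (n + 1)) (closureEmb (K := ℚ) (v.adicCompletion ℚ)))
          (X := subgroupRep T.toTopRep (κ.layerSubgroup (n + 1)))
          (Y := subgroupRep (TopRep.res (resGalOfEmb (closureEmb (K := ℚ) (v.adicCompletion ℚ)) :
              absoluteGaloisGroup (v.adicCompletion ℚ) →* absoluteGaloisGroup ℚ) T.toTopRep)
            (localSubgroupOfEmb (κ.layerSubgroup (n + 1)) (closureEmb (K := ℚ) (v.adicCompletion ℚ))))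
          (TopRep.ofHom ⟨ContinuousLinearMap.id A M, fun _ => rfl⟩) 1 x) :=
  map_resGalSubgroupOfEmb_layerCores (closureEmb (K := ℚ) (v.adicCompletion ℚ)) κ T n
    (forall_exists_layer_cyclotomic κ hκ v hv n) x

end Cyclotomic

end SignedKatoOffTwo.LocalCores

end Summit.BirchSwinnertonDyer.BirchSwinnertonDyer.Theorems

end
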